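import Summits.QuantumFields.GaugeBoot.Certificates.SparseReducedWindow
import Summits.QuantumFields.GaugeBoot.Certificates.KZL2rpLIMb9o5Chi3o2LoDA
import Summits.QuantumFields.GaugeBoot.Certificates.KZL2rpLIMb9o5Chi3o2LoDB
import HarnessLib

/-!
# Kernel replay of the certsdp certificate `kzL2rpLIM_D4_b9o5_lin_chi22-c3o2_lower` — part G: factor-row assembly and objective (gb_lean_emit_win 0.11.0-lim)

HONEST FRAMING (cell `pub-gaugeboot`): certified bounds on lattice expectations at stated coupling,
gauge group, dimension and torus size; NOT a mass gap, NOT a continuum limit, NOT a string tension;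
NOT Yang–Mills-summit-bearing (barriers `FixedCouplingUltralocality`, `PerturbativeInvisibility`).

Certificate sha256 `8a0b83867dfb1327bef6d3fc1d800ff25e4d8902450b9d5e525b95103fc82b84` (problem `kzL2_D4_b9o5_max_rp_hkhd_LIM_G2-lin-chi22-c3o2-lower [objective x144]`, sha256 `090f7982743ea175f97de8c1328233dca420be71f828e038421c34db8d83829a`): `GB` = all factor rows (data parts
`Certificates/KZL2rpLIMb9o5Chi3o2LoD….lean` concatenated), the INTEGER objective row `cZ`, the certified bound `lowerQ`, and the kernel check
`gb_len` (factor rows fit the padded dimension 48). Windows: `Certificates/KZL2rpLIMb9o5Chi3o2LoA….lean`; assembly + theorems: `Certificates/KZL2rpLIMb9o5Chi3o2Lo.lean`.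
Data/plumbing only; nothing is claimed about lattice gauge theory in this file.
-/

namespace Summit.QuantumFields.GaugeBoot.Certificates.KZL2rpLIMb9o5Chi3o2Lo

noncomputable section

open Summit.QuantumFields.GaugeBoot.Certificates.Sparse

/-- All factor rows (concatenation of the data parts' block lists). -/
def GB : List (List (List ℤ)) := GBa ++ GBb

/-- Objective as a sparse INTEGER row: (-48)·y_1 + (144)·y_2 + (-108)·y_13. -/
def cZ : List (ℕ × ℤ) := [(1, Int.negSucc 47), (2, 144), (13, Int.negSucc 107)]

/-- The certified lower bound on the objective (exact): `-275852318493931794125085219997/19125584255622063115468800000` (≈ -14.4232100210399). -/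
def lowerQ : ℚ := -275852318493931794125085219997/19125584255622063115468800000

set_option maxHeartbeats 0 in
/-- Kernel check: every factor row of every block has length `≤ 48`. -/
theorem gb_len : lenCheckAll KZL2rpLIMb9o5Chi3o2Lo.GB 48 75 = true := by
  decide +kernel

end

end Summit.QuantumFields.GaugeBoot.Certificates.KZL2rpLIMb9o5Chi3o2Lo
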